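import Summits.Ventures.PercRepro.DecisionTreeVdBK

/-!
# The van den Berg–Kesten inequality

The classical disjoint occurrence `A □ B` of two events on a finite product of two-point spaces
(`DisjointOccurrence`: witnesses of `A` and of `B` in the same configuration on disjoint edge
sets) and the **van den Berg–Kesten inequality** `P(A □ B) ≤ P(A) · P(B)` for increasing `A`, `B`
(`bk`), obtained from Gladkov's decision-tree inequality `DTree.vdbk` (Theorem 4.3 of
arXiv:2408.08457, `DecisionTreeVdBK.lean`) for the tree `DTree.ofList` that queries every edge
and sends it to `S`: along `S = E` the mixed configuration is `ω` itself and the witnesses must be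
disjoint (`disjOcc_univ_iff`).
-/

namespace PercRepro

open Finset

variable {E : Type*}

/-- The classical disjoint occurrence `A □ B`: witnesses of `A` and `B` in the same
configuration on disjoint edge sets. -/
def DisjointOccurrence (A B : Set (Config E)) : Set (Config E) :=
  {ω | ∃ I J : Set E, Witness A I ω ∧ Witness B J ω ∧ Disjoint I J}

/-- `A □_E B` is the classical disjoint occurrence `A □ B` in the first configuration. -/
theorem disjOcc_univ_iff {A B : Set (Config E)} {ω ω' : Config E} :
    DisjOcc A B Set.univ ω ω' ↔ ω ∈ DisjointOccurrence A B := by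
  have hm : mix Set.univ ω ω' = ω := funext fun e => mix_apply_of_mem (Set.mem_univ e) ω ω'
  simp only [DisjOcc, DisjointOccurrence, Set.mem_setOf_eq, hm, Set.compl_univ, Set.disjoint_iff]

/-! ### The all-`S` tree of a list of edges -/

/-- The tree that queries the edges of a list in order, sending every edge to `S`. -/
def DTree.ofList : List E → DTree E
  | [] => DTree.leaf
  | e :: l => DTree.node e true (fun _ _ => DTree.ofList l)

/-- The all-`S` tree of a list builds the set of its edges. -/
theorem DTree.run_ofList (l : List E) (ω ω' : Config E) :
    DTree.run (DTree.ofList l) ω ω' = {e | e ∈ l} := by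
  induction l with
  | nil => ext x; simp [DTree.ofList, DTree.run]
  | cons e l ih =>
    simp only [DTree.ofList, DTree.run, if_true, ih]
    ext x; simp [List.mem_cons]

/-- The all-`S` tree of a duplicate-free list avoiding `Q` is proper with respect to `Q`. -/
theorem DTree.proper_ofList {l : List E} (hl : l.Nodup) {Q : Set E} (hQ : ∀ e ∈ l, e ∉ Q) :
    DTree.Proper (DTree.ofList l) Q := by
  induction l generalizing Q with
  | nil => simp [DTree.ofList, DTree.Proper]
  | cons e l ih =>
    obtain ⟨hel, hl'⟩ := List.nodup_cons.mp hl
    simp only [DTree.ofList, DTree.Proper]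
    refine ⟨hQ e (by simp), fun _ _ => ih hl' fun x hx hxQ => ?_⟩
    rcases Set.mem_insert_iff.mp hxQ with rfl | hxQ'
    · exact hel hx
    · exact hQ x (List.mem_cons_of_mem e hx) hxQ'

variable [DecidableEq E] [Fintype E]

/-- **The van den Berg–Kesten inequality** on a finite product of two-point spaces: for
increasing events `A`, `B`, `P(A □ B) ≤ P(A) · P(B)` — Theorem 4.3 for the tree that queries
every edge into `S`. -/
theorem bk {p : E → ℝ} (hp : IsProb p) {A B : Set (Config E)} (hA : IsUpperSet A)
    (hB : IsUpperSet B) :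
    prob p (DisjointOccurrence A B) ≤ prob p A * prob p B := by
  have hprop : DTree.Proper (DTree.ofList (Finset.univ : Finset E).toList) ∅ :=
    DTree.proper_ofList (Finset.nodup_toList _) fun e _ h => h
  have h := DTree.vdbk hp hprop hA hB
  have hrun : ∀ ω ω', DTree.run (DTree.ofList (Finset.univ : Finset E).toList) ω ω' = Set.univ := by
    intro ω ω'
    rw [DTree.run_ofList]
    ext x; simp
  simp only [hrun] at h
  refine le_trans (le_of_eq ?_) h
  unfold prob
  refine Finset.sum_congr rfl fun ω _ => ?_
  have hrow : ∀ ω', weight p ω * weight p ω' * disjInd A B Set.univ ω ω' =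
      (DisjointOccurrence A B).indicator (weight p) ω * weight p ω' := by
    intro ω'
    simp only [disjInd]
    by_cases h : ω ∈ DisjointOccurrence A B
    · rw [if_pos (disjOcc_univ_iff.mpr h), Set.indicator_of_mem h]; ring
    · rw [if_neg fun h' => h (disjOcc_univ_iff.mp h'), Set.indicator_of_notMem h]; ring
  simp only [hrow, ← Finset.mul_sum, sum_weight, mul_one]

end PercRepro
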